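import Literature.AlgebraicGeometry.HodgeTheory.PicardLefschetzDataTransport
import Literature.AlgebraicGeometry.Motives.UniversalHypersurfaceBaseChart
import Literature.AlgebraicGeometry.FundamentalGroup.HypersurfaceComplementMeridiansConj
import HarnessLib

/-!
# Concentric circles of a pencil of hypersurfaces are conjugate loops; Picard–Lefschetz data at any radius

Family `hodge`, layer `Literature/AlgebraicGeometry/HodgeTheory`; proof file (theorems only: no definition, no
named fact, no `sorry`). Written by the literature-typing seat `littype-FH1-2` (g21, cell `hodge-nonav`) for the
consumers of the Picard–Lefschetz facts of `HodgeTheory/PicardLefschetzNodalForms` (crux K1-B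
`VeryGeneralSignCommutatorsInHg` of the route `HodgeConjecture/SignSymmetricPowers`, stmt-HodgeConjecture-19716):
those facts produce Picard–Lefschetz data for the circle of an INFINITESIMAL radius `ε < ε₀` of a pencil
`c ↦ f₁ + c·g` around a nodal member, whereas consumers (e.g. the binder hB2-PL, memo
`PROGRAMME-B2PL-19716p2-g8` of the cell, "NOT typed: the homotopy lemma «pencil circles of radii r₁ < r₂ around
an isolated singular member are conjugate-homotopic in U(ℂ)» and a family-level transport-of-PL-data lemma")
meet circles of a prescribed, non-infinitesimal radius. The homotopy lemma is proved here; the transport lemma is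
`PicardLefschetzDataTransport` (prover seat `hodge-nonav-prover-Bx`, same day), on which §5–§6 build.

## The mathematics (Voisin II §3.1.1–3.1.2, §2.3.1; Hatcher §1.1 Lemma 1.19)

Let `U(ℂ)` be the base of the universal family `π : 𝒴_U → U` of smooth hypersurfaces of degree `d` in
`ℙⁿ⁺¹_ℂ` (`Motives.UniversalHypersurface.base ℂ n d`, a point `s` having the form `F_s = pointForm s`).

* **Two-parameter lift** (`exists_continuousMap_pointForm_eq_add_smul`): a continuous family
  `x ↦ f + C(x)·g` of NONSINGULAR members of a pencil, indexed by any topological space, is a continuous map into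
  `U(ℂ)` (the coefficient chart `U(ℂ) ↪ ℂ^{monomials}` is an open embedding — `continuous_pointOfCoeffs_comp` of
  `Motives/UniversalHypersurfaceBaseChart`; Voisin II §6.2.1, Serre GAGA §2 n°5).
* **A free homotopy of loops conjugates by the track of the base point** (Hatcher, Lemma 1.19, the tree's
  `FundamentalGroup.MeridianConj.mk_eq_conj_of_square`): if `C : [0,1]² → ℂ` is continuous with all
  `f + C(t,θ)·g` nonsingular, `c₀, c₁` are loops of `U(ℂ)` with forms `f + C(0,θ)g`, `f + C(1,θ)g` and `α` is a
  path with forms `f + C(t,0)g = f + C(t,1)g`, then `[c₀] = [α]·[c₁]·[α]⁻¹` in the fundamental groupoid of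
  `U(ℂ)` (`mk_eq_conj_of_pencilHomotopy`; points of `U(ℂ)` are determined by their forms, `pointForm_injective`),
  also in the indexing `loopClassUniv` of the rational transports `IsRatTransport` (`loopClassUniv_eq_conj_…`).
* **Concentric circles** (`mk_eq_conj_of_concentric`, `IsPencilCircle.loopClassUniv_eq_conj`, `…_of_norm`): with
  `C(t,θ) = ((1-t)r₂ + t r₁)·e^{2πiθ}` — if every member `f₁ + ρe^{2πiθ}g`, `ρ` between `r₂` and `r₁`, is
  nonsingular (the closed annulus lies in `U`), the circle `γ₂` of radius `r₂` and the circle `γ₁` of radius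
  `r₁` satisfy `[γ₂] = [κ]·[γ₁]·[κ]⁻¹` for the radial segment `κ` from `[f₁ + r₂g]` to `[f₁ + r₁g]` (radial
  projection of the annulus; Voisin II §2.3.1 "a loop going once around the critical value").
* **Transport** (`isRatTransport_conj_of_loopClassUniv_eq`): consequently, if `K` is the rational transport of
  `Rᵏ π_* ℚ` along `κ` and `T₁` the one along `γ₁`, then `K ≫ T₁ ≫ K⁻¹` is THE rational transport along `γ₂`
  (the monodromy representation is a functor on the fundamental groupoid, Voisin II §3.1.2): the monodromies of
  concentric circles are conjugate.
* **Picard–Lefschetz data of concentric circles** (`IsPicardLefschetzData.of_loopClassUniv_eq`,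
  `loopClassUniv_trans_trans_symm`, `IsPicardLefschetzData.exists_of_concentric`): `IsPicardLefschetzData` sees the
  loop only through its homotopy class; combined with the transport of Picard–Lefschetz data along the radial
  segment for a FLAT coefficient (`IsPicardLefschetzData.exists_transport` of `PicardLefschetzDataTransport`,
  prover seat `hodge-nonav-prover-Bx`: the data `(δᵢ; c(s₁))` of `γ₁` become data `(Φδᵢ; c(s₂))` of `κ·γ₁·κ⁻¹`;
  Voisin II §3.2.2, the cycle `δ_γ` of a conjugate loop), data for the circle of radius `ε₁` yield data for the
  circle of radius `ε₂` whenever the closed annulus consists of nonsingular members.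
* **Picard–Lefschetz data at any radius** (`picardLefschetz_nodalForms_uniform.exists_isPicardLefschetzData_of_radius`):
  the named fact `picardLefschetz_nodalForms_uniform` (Voisin II Thm. 3.16 with a flat coefficient) hence gives,
  for a `k`-nodal `f₁`, `g` missing the nodes, and ANY radius `r > 0` such that all `f₁ + c'g`, `0 < |c'| ≤ r`, are
  nonsingular, Picard–Lefschetz data with coefficient `c(s)` for every circle of radius `r` of the pencil at the
  point `s` of `f₁ + r g` (the shape in which consumers such as hB2-PL's clauses (P1), (P2) meet the fact).
* **Packaged shapes** (§7, `IsPencilCircle.pointForm_base`, `IsPencilCircle.exists_concentric`,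
  `IsPencilCircle.exists_concentric_ratTransport`): from a GIVEN outer circle, the inner point, circle, radial
  segment, class relation and conjugation of rational transports are produced in one `∃`.

Everything is stated on the tree's carriers exactly as in `PicardLefschetzNodalForms` (`pointForm`, `IsPencilCircle`,
`loopClassUniv`, `IsRatTransport`, `IsPicardLefschetzData`, `IsFlatCoefficient`); no new notion is introduced.
Complex "radii" `r ∈ ℂ` in §3 record the starting point of a circle, so that the circles `b = (ψ/2)e^{2πiθ}` and
`b = ψ - (ψ/2)e^{2πiθ}` of `PicardLefschetzSymmetricA3` (the latter as `f₁' + (r e^{2πiθ})g₀` with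
`f₁' = f₁ + a'g₂ + ψ g₀`, `r = -ψ/2`) are covered.

## References

* [VoisinHodgeII2003] C. Voisin, Hodge Theory and Complex Algebraic Geometry II, CUP 2003, §2.3.1 (loops around
  critical values), §3.1.1–3.1.2 (local systems, the monodromy representation `ρ : π₁(Y, y) → GL(F_y)`, functorial
  in the path), §3.2.1 Thm. 3.16, §3.2.3, §6.2.1.
* [Hatcher2002] A. Hatcher, Algebraic Topology, CUP 2002, §1.1 Lemma 1.19 (p. 37): a free homotopy of loops
  conjugates by the track of the base point.
* [ArnoldGuseinzadeVarchenko2012] V. I. Arnold, S. M. Gusein-Zade, A. N. Varchenko, Singularities of Differentiable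
  Maps II, Part I §1.3 (the loop `τ'(t) = exp(2πit)` of the Picard–Lefschetz theorem), §5.2.
* [SerreGAGA1956] J.-P. Serre, Géométrie algébrique et géométrie analytique, Ann. Inst. Fourier 6 (1956), §2 n°5.
-/

noncomputable section

open CategoryTheory AlgebraicGeometry MvPolynomial
open Literature.AlgebraicTopology.SingularHomology
open Literature.AlgebraicGeometry.Motives Literature.AlgebraicGeometry.Motives.UniversalHypersurface
open Literature.AlgebraicGeometry.FundamentalGroup

namespace Literature.AlgebraicGeometry.HodgeTheory

section HodgeTheory

variable {n d : ℕ}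

/-! ### §1 Continuous families of nonsingular members of a pencil are continuous maps into `U(ℂ)` -/

/-- **Two-parameter (indeed any-parameter) lift through the coefficient chart**: if `C : X → ℂ` is continuous
and every `f + C(x)·g` is nonsingular, then `x ↦ [f + C(x)·g]` is a continuous map `X → U(ℂ)` with the
prescribed forms (the one-parameter cases are `exists_path_pointForm_pencil` / `exists_path_pointForm_eq_add_smul`
of `Motives/UniversalHypersurfaceBaseChart`). [cite: VoisinHodgeII2003, §6.2.1] [cite: SerreGAGA1956, §2 n°5] -/
theorem exists_continuousMap_pointForm_eq_add_smul {X : Type*} [TopologicalSpace X]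
    {f g : MvPolynomial (Fin (n + 2)) ℂ} (hf : f.IsHomogeneous d) (hg : g.IsHomogeneous d)
    {C : X → ℂ} (hC : Continuous C) (hJ : ∀ x, SmoothHypersurface.IsNonsingularForm ℂ (f + C x • g)) :
    ∃ Φ : C(X, ComplexPoints (base ℂ n d)), ∀ x, pointForm ℂ n d (Φ x) = f + C x • g := by
  let a : X → DegIndex n d → ℂ := fun x m => coeff m.1 f + C x * coeff m.1 g
  have hform : ∀ x, formOfCoeffs (a x) = f + C x • g := fun x => by
    have h1 : a x = (fun m : DegIndex n d => coeff m.1 (f + C x • g)) :=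
      funext fun m => by simp [a, coeff_add, coeff_smul, smul_eq_mul]
    rw [h1, formOfCoeffs_coeff]
    exact isHomogeneous_add_smul hf hg _
  have hJ' : ∀ x, SmoothHypersurface.IsNonsingularForm ℂ (formOfCoeffs (a x)) := fun x => by
    rw [hform]; exact hJ x
  have ha : Continuous a := continuous_pi fun m => continuous_const.add (hC.mul continuous_const)
  refine ⟨⟨fun x => pointOfCoeffs ℂ n d (a x) (hJ' x), continuous_pointOfCoeffs_comp ℂ n d ha hJ'⟩,
    fun x => ?_⟩
  change pointForm ℂ n d (pointOfCoeffs ℂ n d (a x) (hJ' x)) = _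
  rw [pointForm_pointOfCoeffs, hform]

/-! ### §2 A free homotopy of pencil loops conjugates by the track of the base point -/

/-- **Free homotopies of loops in a pencil conjugate.** Let `C : [0,1]² → ℂ` be continuous with every
`f + C(t,θ)·g` nonsingular, let `c₀`, `c₁` be loops of `U(ℂ)` whose forms are `f + C(0,θ)g`, `f + C(1,θ)g`, and
`α` a path whose forms are `f + C(t,0)g = f + C(t,1)g`. Then `[c₀] = [α]·[c₁]·[α]⁻¹` in the fundamental groupoid
of `U(ℂ)`. [cite: Hatcher2002, §1.1 Lemma 1.19 (p. 37)] [cite: VoisinHodgeII2003, §3.1.1 and §6.2.1] -/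
theorem mk_eq_conj_of_pencilHomotopy {f g : MvPolynomial (Fin (n + 2)) ℂ} (hf : f.IsHomogeneous d)
    (hg : g.IsHomogeneous d) {C : unitInterval × unitInterval → ℂ} (hC : Continuous C)
    (hJ : ∀ p, SmoothHypersurface.IsNonsingularForm ℂ (f + C p • g))
    {e₀ e₁ : ComplexPoints (base ℂ n d)} (c₀ : Path e₀ e₀) (c₁ : Path e₁ e₁) (α : Path e₀ e₁)
    (h₀ : ∀ θ, pointForm ℂ n d (c₀ θ) = f + C (0, θ) • g)
    (h₁ : ∀ θ, pointForm ℂ n d (c₁ θ) = f + C (1, θ) • g)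
    (hb : ∀ t, pointForm ℂ n d (α t) = f + C (t, 0) • g)
    (ht : ∀ t, pointForm ℂ n d (α t) = f + C (t, 1) • g) :
    Path.Homotopic.Quotient.mk c₀ =
      (Path.Homotopic.Quotient.mk α).trans
        ((Path.Homotopic.Quotient.mk c₁).trans (Path.Homotopic.Quotient.mk α).symm) := by
  obtain ⟨Φ, hΦ⟩ :=
    exists_continuousMap_pointForm_eq_add_smul (X := unitInterval × unitInterval) hf hg hC hJ
  exact MeridianConj.mk_eq_conj_of_square Φ c₀ c₁ α
    (fun θ => pointForm_injective ℂ n d (by rw [hΦ, h₀]))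
    (fun θ => pointForm_injective ℂ n d (by rw [hΦ, h₁]))
    (fun t => pointForm_injective ℂ n d (by rw [hΦ, hb]))
    (fun t => pointForm_injective ℂ n d (by rw [hΦ, ht]))

/-- The same relation in the indexing `loopClassUniv` / `Set.univ ⊆ U(ℂ)` of the rational transports
`IsRatTransport` of the universal family: `loopClassUniv c₀ = [α]·loopClassUniv c₁·[α]⁻¹`, `α` pushed into
`Set.univ` by `toUniv`. [cite: Hatcher2002, §1.1 Lemma 1.19 (p. 37)] [cite: VoisinHodgeII2003, §3.1.2] -/
theorem loopClassUniv_eq_conj_of_pencilHomotopy {f g : MvPolynomial (Fin (n + 2)) ℂ}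
    (hf : f.IsHomogeneous d) (hg : g.IsHomogeneous d) {C : unitInterval × unitInterval → ℂ}
    (hC : Continuous C) (hJ : ∀ p, SmoothHypersurface.IsNonsingularForm ℂ (f + C p • g))
    {e₀ e₁ : ComplexPoints (base ℂ n d)} (c₀ : Path e₀ e₀) (c₁ : Path e₁ e₁) (α : Path e₀ e₁)
    (h₀ : ∀ θ, pointForm ℂ n d (c₀ θ) = f + C (0, θ) • g)
    (h₁ : ∀ θ, pointForm ℂ n d (c₁ θ) = f + C (1, θ) • g)
    (hb : ∀ t, pointForm ℂ n d (α t) = f + C (t, 0) • g)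
    (ht : ∀ t, pointForm ℂ n d (α t) = f + C (t, 1) • g) :
    loopClassUniv n d c₀ =
      (Path.Homotopic.Quotient.mk (α.map (toUniv n d).continuous)).trans
        ((loopClassUniv n d c₁).trans
          (Path.Homotopic.Quotient.mk (α.map (toUniv n d).continuous)).symm) := by
  obtain ⟨Φ, hΦ⟩ :=
    exists_continuousMap_pointForm_eq_add_smul (X := unitInterval × unitInterval) hf hg hC hJ
  exact MeridianConj.mk_eq_conj_of_square ((toUniv n d).comp Φ) (c₀.map (toUniv n d).continuous)
    (c₁.map (toUniv n d).continuous) (α.map (toUniv n d).continuous)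
    (fun θ => congrArg (toUniv n d) (pointForm_injective ℂ n d (by rw [hΦ, h₀])))
    (fun θ => congrArg (toUniv n d) (pointForm_injective ℂ n d (by rw [hΦ, h₁])))
    (fun t => congrArg (toUniv n d) (pointForm_injective ℂ n d (by rw [hΦ, hb])))
    (fun t => congrArg (toUniv n d) (pointForm_injective ℂ n d (by rw [hΦ, ht])))

/-! ### §3 Concentric circles of a pencil -/

/-- The radial homotopy `C(t, θ) = ((1-t)·r₂ + t·r₁)·e^{2πiθ}` between the circles of "radii" `r₂, r₁ ∈ ℂ`
(a complex radius records the starting point of the circle) is continuous. [cite: VoisinHodgeII2003, §2.3.1] -/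
private theorem continuous_radialHomotopy (r₂ r₁ : ℂ) :
    Continuous fun p : unitInterval × unitInterval =>
      ((1 - ((p.1 : ℝ) : ℂ)) * r₂ + ((p.1 : ℝ) : ℂ) * r₁) *
        Complex.exp (2 * Real.pi * Complex.I * ((p.2 : ℝ) : ℂ)) := by
  fun_prop

/-- Casting the real radial parameter into `ℂ`. [folklore] -/
private theorem radial_cast (t : unitInterval) (ε₂ ε₁ : ℝ) :
    ((((1 - (t : ℝ)) * ε₂ + (t : ℝ) * ε₁ : ℝ)) : ℂ) =
      (1 - ((t : ℝ) : ℂ)) * (ε₂ : ℂ) + ((t : ℝ) : ℂ) * (ε₁ : ℂ) := by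
  simp only [Complex.ofReal_add, Complex.ofReal_mul, Complex.ofReal_sub, Complex.ofReal_one]

/-- The real radial parameter stays between the two radii. [folklore] -/
private theorem radial_mem_uIcc (t : unitInterval) (ε₂ ε₁ : ℝ) :
    (1 - (t : ℝ)) * ε₂ + (t : ℝ) * ε₁ ∈ Set.uIcc ε₂ ε₁ := by
  rw [← segment_eq_uIcc]
  exact ⟨1 - (t : ℝ), (t : ℝ), sub_nonneg.2 t.2.2, t.2.1, sub_add_cancel _ _, rfl⟩

/-- From nonsingularity on real radii between `ε₂` and `ε₁` to nonsingularity on the complex segment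
`[ε₂, ε₁] ⊆ ℂ`. [folklore] -/
private theorem nonsingular_segment_of_uIcc {f₁ g : MvPolynomial (Fin (n + 2)) ℂ} {ε₂ ε₁ : ℝ}
    (hJ : ∀ ρ ∈ Set.uIcc ε₂ ε₁, ∀ θ : unitInterval, SmoothHypersurface.IsNonsingularForm ℂ
      (f₁ + ((ρ : ℂ) * Complex.exp (2 * Real.pi * Complex.I * ((θ : ℝ) : ℂ))) • g)) :
    ∀ ρ ∈ segment ℝ (ε₂ : ℂ) (ε₁ : ℂ), ∀ θ : unitInterval, SmoothHypersurface.IsNonsingularForm ℂ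
      (f₁ + (ρ * Complex.exp (2 * Real.pi * Complex.I * ((θ : ℝ) : ℂ))) • g) := by
  rintro ρ ⟨a, b, ha, hb, hab, rfl⟩ θ
  have hmem : a * ε₂ + b * ε₁ ∈ Set.uIcc ε₂ ε₁ := by
    rw [← segment_eq_uIcc]; exact ⟨a, b, ha, hb, hab, rfl⟩
  simpa [Complex.real_smul] using hJ _ hmem θ

/-- From the annulus hypothesis on norms (non-negative radii) to the hypothesis on real radii. [folklore] -/
private theorem nonsingular_uIcc_of_norm {f₁ g : MvPolynomial (Fin (n + 2)) ℂ} {ε₂ ε₁ : ℝ} (hε₂ : 0 ≤ ε₂)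
    (hε₁ : 0 ≤ ε₁)
    (hJ : ∀ c' : ℂ, ‖c'‖ ∈ Set.uIcc ε₂ ε₁ → SmoothHypersurface.IsNonsingularForm ℂ (f₁ + c' • g)) :
    ∀ ρ ∈ Set.uIcc ε₂ ε₁, ∀ θ : unitInterval, SmoothHypersurface.IsNonsingularForm ℂ
      (f₁ + ((ρ : ℂ) * Complex.exp (2 * Real.pi * Complex.I * ((θ : ℝ) : ℂ))) • g) := by
  intro ρ hρ θ
  refine hJ _ ?_
  have hρ0 : 0 ≤ ρ := by
    rcases Set.mem_uIcc.1 hρ with h | h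
    exacts [hε₂.trans h.1, hε₁.trans h.1]
  have hnorm : ‖(ρ : ℂ) * Complex.exp (2 * Real.pi * Complex.I * ((θ : ℝ) : ℂ))‖ = ρ := by
    rw [← pencilParam_apply, norm_pencilParam, abs_of_nonneg hρ0]
  rw [hnorm]
  exact hρ

/-- **Concentric circles of a pencil are conjugate loops.** Let `r₂, r₁ ∈ ℂ` and suppose every member
`f₁ + (ρ e^{2πiθ})·g` with `ρ` on the segment `[r₂, r₁]` is nonsingular. If `γ₂`, `γ₁` are loops of `U(ℂ)`
with forms `f₁ + (r₂e^{2πiθ})g`, `f₁ + (r₁e^{2πiθ})g` and `κ` is a path with forms `f₁ + ((1-t)r₂ + t r₁)g`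
(the radial segment), then `[γ₂] = [κ]·[γ₁]·[κ]⁻¹` in the fundamental groupoid of `U(ℂ)` (radial projection of
the annulus: the free homotopy `((1-t)r₂ + t r₁)e^{2πiθ}`). [cite: VoisinHodgeII2003, §2.3.1 and §3.1.1]
[cite: Hatcher2002, §1.1 Lemma 1.19 (p. 37)] -/
theorem mk_eq_conj_of_concentric {f₁ g : MvPolynomial (Fin (n + 2)) ℂ} (hf₁ : f₁.IsHomogeneous d)
    (hg : g.IsHomogeneous d) {r₂ r₁ : ℂ}
    (hJ : ∀ ρ ∈ segment ℝ r₂ r₁, ∀ θ : unitInterval, SmoothHypersurface.IsNonsingularForm ℂ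
      (f₁ + (ρ * Complex.exp (2 * Real.pi * Complex.I * ((θ : ℝ) : ℂ))) • g))
    {s₂ s₁ : ComplexPoints (base ℂ n d)} (γ₂ : Path s₂ s₂) (γ₁ : Path s₁ s₁) (κ : Path s₂ s₁)
    (h₂ : ∀ θ : unitInterval, pointForm ℂ n d (γ₂ θ) =
      f₁ + (r₂ * Complex.exp (2 * Real.pi * Complex.I * ((θ : ℝ) : ℂ))) • g)
    (h₁ : ∀ θ : unitInterval, pointForm ℂ n d (γ₁ θ) =
      f₁ + (r₁ * Complex.exp (2 * Real.pi * Complex.I * ((θ : ℝ) : ℂ))) • g)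
    (hκ : ∀ t : unitInterval, pointForm ℂ n d (κ t) =
      f₁ + ((1 - ((t : ℝ) : ℂ)) * r₂ + ((t : ℝ) : ℂ) * r₁) • g) :
    Path.Homotopic.Quotient.mk γ₂ =
      (Path.Homotopic.Quotient.mk κ).trans
        ((Path.Homotopic.Quotient.mk γ₁).trans (Path.Homotopic.Quotient.mk κ).symm) := by
  refine mk_eq_conj_of_pencilHomotopy hf₁ hg (continuous_radialHomotopy r₂ r₁) (fun p => ?_) γ₂ γ₁ κ
    (fun θ => ?_) (fun θ => ?_) (fun t => ?_) (fun t => ?_)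
  · refine hJ _ ⟨1 - (p.1 : ℝ), (p.1 : ℝ), sub_nonneg.2 p.1.2.2, p.1.2.1, sub_add_cancel _ _, ?_⟩ p.2
    simp [Complex.real_smul]
  · rw [h₂]; simp
  · rw [h₁]; simp
  · rw [hκ]; simp
  · rw [hκ]; simp [Complex.exp_two_pi_mul_I]

/-- The same relation in the indexing `loopClassUniv` of the rational transports. [cite: VoisinHodgeII2003, §2.3.1 and §3.1.2]
[cite: Hatcher2002, §1.1 Lemma 1.19 (p. 37)] -/
theorem loopClassUniv_eq_conj_of_concentric {f₁ g : MvPolynomial (Fin (n + 2)) ℂ} (hf₁ : f₁.IsHomogeneous d)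
    (hg : g.IsHomogeneous d) {r₂ r₁ : ℂ}
    (hJ : ∀ ρ ∈ segment ℝ r₂ r₁, ∀ θ : unitInterval, SmoothHypersurface.IsNonsingularForm ℂ
      (f₁ + (ρ * Complex.exp (2 * Real.pi * Complex.I * ((θ : ℝ) : ℂ))) • g))
    {s₂ s₁ : ComplexPoints (base ℂ n d)} (γ₂ : Path s₂ s₂) (γ₁ : Path s₁ s₁) (κ : Path s₂ s₁)
    (h₂ : ∀ θ : unitInterval, pointForm ℂ n d (γ₂ θ) =
      f₁ + (r₂ * Complex.exp (2 * Real.pi * Complex.I * ((θ : ℝ) : ℂ))) • g)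
    (h₁ : ∀ θ : unitInterval, pointForm ℂ n d (γ₁ θ) =
      f₁ + (r₁ * Complex.exp (2 * Real.pi * Complex.I * ((θ : ℝ) : ℂ))) • g)
    (hκ : ∀ t : unitInterval, pointForm ℂ n d (κ t) =
      f₁ + ((1 - ((t : ℝ) : ℂ)) * r₂ + ((t : ℝ) : ℂ) * r₁) • g) :
    loopClassUniv n d γ₂ =
      (Path.Homotopic.Quotient.mk (κ.map (toUniv n d).continuous)).trans
        ((loopClassUniv n d γ₁).trans
          (Path.Homotopic.Quotient.mk (κ.map (toUniv n d).continuous)).symm) := by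
  refine loopClassUniv_eq_conj_of_pencilHomotopy hf₁ hg (continuous_radialHomotopy r₂ r₁) (fun p => ?_)
    γ₂ γ₁ κ (fun θ => ?_) (fun θ => ?_) (fun t => ?_) (fun t => ?_)
  · refine hJ _ ⟨1 - (p.1 : ℝ), (p.1 : ℝ), sub_nonneg.2 p.1.2.2, p.1.2.1, sub_add_cancel _ _, ?_⟩ p.2
    simp [Complex.real_smul]
  · rw [h₂]; simp
  · rw [h₁]; simp
  · rw [hκ]; simp
  · rw [hκ]; simp [Complex.exp_two_pi_mul_I]

/-- **Concentric pencil circles of real radii are conjugate loops** (`IsPencilCircle` idiom of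
`PicardLefschetzNodalForms`): if every member `f₁ + (ρe^{2πiθ})·g` with `ρ` between `ε₂` and `ε₁` is
nonsingular, `γ₂`, `γ₁` are the circles of radii `ε₂`, `ε₁` of the pencil at the points of `f₁ + ε₂g`, `f₁ + ε₁g`
and `κ` is the radial segment (forms `f₁ + ((1-t)ε₂ + tε₁)g`), then `[γ₂] = [κ]·[γ₁]·[κ]⁻¹` in the fundamental
groupoid of `U(ℂ)`. [cite: VoisinHodgeII2003, §2.3.1 and §3.1.1] [cite: Hatcher2002, §1.1 Lemma 1.19 (p. 37)] -/
theorem IsPencilCircle.mk_eq_conj {f₁ g : MvPolynomial (Fin (n + 2)) ℂ} (hf₁ : f₁.IsHomogeneous d)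
    (hg : g.IsHomogeneous d) {ε₂ ε₁ : ℝ}
    (hJ : ∀ ρ ∈ Set.uIcc ε₂ ε₁, ∀ θ : unitInterval, SmoothHypersurface.IsNonsingularForm ℂ
      (f₁ + ((ρ : ℂ) * Complex.exp (2 * Real.pi * Complex.I * ((θ : ℝ) : ℂ))) • g))
    {s₂ s₁ : ComplexPoints (base ℂ n d)} {γ₂ : Path s₂ s₂} {γ₁ : Path s₁ s₁}
    (h₂ : IsPencilCircle n d f₁ g ε₂ γ₂) (h₁ : IsPencilCircle n d f₁ g ε₁ γ₁) (κ : Path s₂ s₁)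
    (hκ : ∀ t : unitInterval, pointForm ℂ n d (κ t) =
      f₁ + (((1 - (t : ℝ)) * ε₂ + (t : ℝ) * ε₁ : ℝ) : ℂ) • g) :
    Path.Homotopic.Quotient.mk γ₂ =
      (Path.Homotopic.Quotient.mk κ).trans
        ((Path.Homotopic.Quotient.mk γ₁).trans (Path.Homotopic.Quotient.mk κ).symm) :=
  mk_eq_conj_of_concentric hf₁ hg (nonsingular_segment_of_uIcc hJ) γ₂ γ₁ κ h₂ h₁
    (fun t => by rw [hκ, radial_cast])

/-- The `loopClassUniv` form of `IsPencilCircle.mk_eq_conj` (the indexing of `IsRatTransport`).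
[cite: VoisinHodgeII2003, §2.3.1 and §3.1.2] [cite: Hatcher2002, §1.1 Lemma 1.19 (p. 37)] -/
theorem IsPencilCircle.loopClassUniv_eq_conj {f₁ g : MvPolynomial (Fin (n + 2)) ℂ} (hf₁ : f₁.IsHomogeneous d)
    (hg : g.IsHomogeneous d) {ε₂ ε₁ : ℝ}
    (hJ : ∀ ρ ∈ Set.uIcc ε₂ ε₁, ∀ θ : unitInterval, SmoothHypersurface.IsNonsingularForm ℂ
      (f₁ + ((ρ : ℂ) * Complex.exp (2 * Real.pi * Complex.I * ((θ : ℝ) : ℂ))) • g))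
    {s₂ s₁ : ComplexPoints (base ℂ n d)} {γ₂ : Path s₂ s₂} {γ₁ : Path s₁ s₁}
    (h₂ : IsPencilCircle n d f₁ g ε₂ γ₂) (h₁ : IsPencilCircle n d f₁ g ε₁ γ₁) (κ : Path s₂ s₁)
    (hκ : ∀ t : unitInterval, pointForm ℂ n d (κ t) =
      f₁ + (((1 - (t : ℝ)) * ε₂ + (t : ℝ) * ε₁ : ℝ) : ℂ) • g) :
    loopClassUniv n d γ₂ =
      (Path.Homotopic.Quotient.mk (κ.map (toUniv n d).continuous)).trans
        ((loopClassUniv n d γ₁).trans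
          (Path.Homotopic.Quotient.mk (κ.map (toUniv n d).continuous)).symm) :=
  loopClassUniv_eq_conj_of_concentric hf₁ hg (nonsingular_segment_of_uIcc hJ) γ₂ γ₁ κ h₂ h₁
    (fun t => by rw [hκ, radial_cast])

/-- **Concentric pencil circles, annulus form**: if `0 ≤ ε₂, ε₁` and every `f₁ + c'·g` with `|c'|` between `ε₂`
and `ε₁` is nonsingular (the closed annulus lies in `U`), the circles of radii `ε₂`, `ε₁` satisfy
`[γ₂] = [κ]·[γ₁]·[κ]⁻¹` for the radial segment `κ`. [cite: VoisinHodgeII2003, §2.3.1 and §3.1.1]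
[cite: Hatcher2002, §1.1 Lemma 1.19 (p. 37)] -/
theorem IsPencilCircle.mk_eq_conj_of_norm {f₁ g : MvPolynomial (Fin (n + 2)) ℂ} (hf₁ : f₁.IsHomogeneous d)
    (hg : g.IsHomogeneous d) {ε₂ ε₁ : ℝ} (hε₂ : 0 ≤ ε₂) (hε₁ : 0 ≤ ε₁)
    (hJ : ∀ c' : ℂ, ‖c'‖ ∈ Set.uIcc ε₂ ε₁ → SmoothHypersurface.IsNonsingularForm ℂ (f₁ + c' • g))
    {s₂ s₁ : ComplexPoints (base ℂ n d)} {γ₂ : Path s₂ s₂} {γ₁ : Path s₁ s₁}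
    (h₂ : IsPencilCircle n d f₁ g ε₂ γ₂) (h₁ : IsPencilCircle n d f₁ g ε₁ γ₁) (κ : Path s₂ s₁)
    (hκ : ∀ t : unitInterval, pointForm ℂ n d (κ t) =
      f₁ + (((1 - (t : ℝ)) * ε₂ + (t : ℝ) * ε₁ : ℝ) : ℂ) • g) :
    Path.Homotopic.Quotient.mk γ₂ =
      (Path.Homotopic.Quotient.mk κ).trans
        ((Path.Homotopic.Quotient.mk γ₁).trans (Path.Homotopic.Quotient.mk κ).symm) :=
  h₂.mk_eq_conj hf₁ hg (nonsingular_uIcc_of_norm hε₂ hε₁ hJ) h₁ κ hκ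

/-- The `loopClassUniv` form of `IsPencilCircle.mk_eq_conj_of_norm`. [cite: VoisinHodgeII2003, §2.3.1 and §3.1.2]
[cite: Hatcher2002, §1.1 Lemma 1.19 (p. 37)] -/
theorem IsPencilCircle.loopClassUniv_eq_conj_of_norm {f₁ g : MvPolynomial (Fin (n + 2)) ℂ}
    (hf₁ : f₁.IsHomogeneous d) (hg : g.IsHomogeneous d) {ε₂ ε₁ : ℝ} (hε₂ : 0 ≤ ε₂) (hε₁ : 0 ≤ ε₁)
    (hJ : ∀ c' : ℂ, ‖c'‖ ∈ Set.uIcc ε₂ ε₁ → SmoothHypersurface.IsNonsingularForm ℂ (f₁ + c' • g))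
    {s₂ s₁ : ComplexPoints (base ℂ n d)} {γ₂ : Path s₂ s₂} {γ₁ : Path s₁ s₁}
    (h₂ : IsPencilCircle n d f₁ g ε₂ γ₂) (h₁ : IsPencilCircle n d f₁ g ε₁ γ₁) (κ : Path s₂ s₁)
    (hκ : ∀ t : unitInterval, pointForm ℂ n d (κ t) =
      f₁ + (((1 - (t : ℝ)) * ε₂ + (t : ℝ) * ε₁ : ℝ) : ℂ) • g) :
    loopClassUniv n d γ₂ =
      (Path.Homotopic.Quotient.mk (κ.map (toUniv n d).continuous)).trans
        ((loopClassUniv n d γ₁).trans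
          (Path.Homotopic.Quotient.mk (κ.map (toUniv n d).continuous)).symm) :=
  h₂.loopClassUniv_eq_conj hf₁ hg (nonsingular_uIcc_of_norm hε₂ hε₁ hJ) h₁ κ hκ

/-- **The radial segment of a pencil is a path in `U(ℂ)`**: if every `f₁ + ρ·g`, `ρ` between `ε₂` and `ε₁`, is
nonsingular, there is a path `κ` from the point of `f₁ + ε₂g` to the point of `f₁ + ε₁g` with forms
`f₁ + ((1-t)ε₂ + tε₁)g`. [cite: VoisinHodgeII2003, §3.1.1 and §6.2.1] [cite: SerreGAGA1956, §2 n°5] -/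
theorem exists_path_pointForm_radialSegment {f₁ g : MvPolynomial (Fin (n + 2)) ℂ}
    (hf₁ : f₁.IsHomogeneous d) (hg : g.IsHomogeneous d) {ε₂ ε₁ : ℝ}
    (hJ : ∀ ρ ∈ Set.uIcc ε₂ ε₁, SmoothHypersurface.IsNonsingularForm ℂ (f₁ + (ρ : ℂ) • g))
    (s₂ s₁ : ComplexPoints (base ℂ n d)) (hs₂ : pointForm ℂ n d s₂ = f₁ + (ε₂ : ℂ) • g)
    (hs₁ : pointForm ℂ n d s₁ = f₁ + (ε₁ : ℂ) • g) :
    ∃ κ : Path s₂ s₁, ∀ t : unitInterval, pointForm ℂ n d (κ t) =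
      f₁ + (((1 - (t : ℝ)) * ε₂ + (t : ℝ) * ε₁ : ℝ) : ℂ) • g := by
  refine exists_path_pointForm_eq_add_smul' n d hf₁ hg
    (c := fun t : unitInterval => (((1 - (t : ℝ)) * ε₂ + (t : ℝ) * ε₁ : ℝ) : ℂ)) (by fun_prop)
    (fun t => hJ _ (radial_mem_uIcc t ε₂ ε₁)) s₂ s₁ (by rw [hs₂]; simp) (by rw [hs₁]; simp)

/-- **The circle of radius `ε` of a pencil is a loop `IsPencilCircle`** at the point of `f₁ + ε·g`, as soon as
all members `f₁ + c'·g`, `|c'| = |ε|`, are nonsingular (`exists_path_pointForm_pencil` in the `IsPencilCircle`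
idiom). [cite: VoisinHodgeII2003, §2.3.1 and §6.2.1] -/
theorem exists_isPencilCircle {f₁ g : MvPolynomial (Fin (n + 2)) ℂ} (hf₁ : f₁.IsHomogeneous d)
    (hg : g.IsHomogeneous d) {ε : ℝ}
    (hJ : ∀ c' : ℂ, ‖c'‖ = |ε| → SmoothHypersurface.IsNonsingularForm ℂ (f₁ + c' • g))
    (s : ComplexPoints (base ℂ n d)) (hs : pointForm ℂ n d s = f₁ + (ε : ℂ) • g) :
    ∃ γ : Path s s, IsPencilCircle n d f₁ g ε γ :=
  exists_path_pointForm_pencil n d hf₁ hg hJ s hs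

/-! ### §4 Monodromies of conjugate loops are conjugate -/

section Transport

variable (hU : IsCohomologicallyLocallyTrivialOn (family ℂ n d) Set.univ)

/-- **Transport along a conjugate loop.** If `loopClassUniv γ₂ = κ'·loopClassUniv γ₁·κ'⁻¹` for a path class
`κ'` from `s₂` to `s₁`, `K` is the rational transport of `Rᵏ π_* ℚ` along `κ'` and `T` the one along `γ₁`, then
`K ≫ T ≫ K⁻¹` is the rational transport along `γ₂` (the monodromy representation is functorial in the path).
[cite: VoisinHodgeII2003, §3.1.2] -/
theorem isRatTransport_conj_of_loopClassUniv_eq {k' : ℕ} {s₂ s₁ : ComplexPoints (base ℂ n d)}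
    {γ₂ : Path s₂ s₂} {γ₁ : Path s₁ s₁} {κ' : Path.Homotopic.Quotient (toUniv n d s₂) (toUniv n d s₁)}
    (h : loopClassUniv n d γ₂ = κ'.trans ((loopClassUniv n d γ₁).trans κ'.symm))
    {K : bettiCohomology (fiberOver (family ℂ n d) s₂) k' ≃ₗ[ℚ] bettiCohomology (fiberOver (family ℂ n d) s₁) k'}
    (hK : IsRatTransport (family ℂ n d) k' hU κ' K)
    {T : bettiCohomology (fiberOver (family ℂ n d) s₁) k' ≃ₗ[ℚ] bettiCohomology (fiberOver (family ℂ n d) s₁) k'}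
    (hT : IsRatTransport (family ℂ n d) k' hU (loopClassUniv n d γ₁) T) :
    IsRatTransport (family ℂ n d) k' hU (loopClassUniv n d γ₂) (K.trans (T.trans K.symm)) := by
  rw [h]
  exact hK.trans (family ℂ n d) k' hU (hT.trans (family ℂ n d) k' hU (hK.symm (family ℂ n d) k' hU))

/-- In particular a monodromy transformation of `γ₁` conjugated by the transport along `κ'` is a monodromy
transformation at `s₂` (an element of `ratMonodromyGroup π k' hU s₂`). [cite: VoisinHodgeII2003, §3.1.2]
[cite: CarlsonMullerStachPeters2017, Lemma–Definition 15.3.7] -/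
theorem conj_mem_ratMonodromyGroup_of_loopClassUniv_eq {k' : ℕ} {s₂ s₁ : ComplexPoints (base ℂ n d)}
    {γ₂ : Path s₂ s₂} {γ₁ : Path s₁ s₁} {κ' : Path.Homotopic.Quotient (toUniv n d s₂) (toUniv n d s₁)}
    (h : loopClassUniv n d γ₂ = κ'.trans ((loopClassUniv n d γ₁).trans κ'.symm))
    {K : bettiCohomology (fiberOver (family ℂ n d) s₂) k' ≃ₗ[ℚ] bettiCohomology (fiberOver (family ℂ n d) s₁) k'}
    (hK : IsRatTransport (family ℂ n d) k' hU κ' K)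
    {T : bettiCohomology (fiberOver (family ℂ n d) s₁) k' ≃ₗ[ℚ] bettiCohomology (fiberOver (family ℂ n d) s₁) k'}
    (hT : IsRatTransport (family ℂ n d) k' hU (loopClassUniv n d γ₁) T) :
    K.trans (T.trans K.symm) ∈ ratMonodromyGroup (family ℂ n d) k' hU (toUniv n d s₂) :=
  ⟨loopClassUniv n d γ₂, isRatTransport_conj_of_loopClassUniv_eq hU h hK hT⟩

end Transport

/-! ### §5 Picard–Lefschetz data depend on the loop only through its homotopy class -/

section Homotopy

variable {hn : 1 ≤ n} {hd : 1 ≤ d} {hU : IsCohomologicallyLocallyTrivialOn (family ℂ n d) Set.univ}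

/-- **Picard–Lefschetz data are homotopy invariant**: `IsPicardLefschetzData` sees the loop `γ` only through its
class `loopClassUniv γ` (the rational transports are indexed by homotopy classes), so data for `γ` are data for
every `γ'` with the same class. [cite: VoisinHodgeII2003, §3.1.2 and §3.2.1 Thm. 3.16] -/
theorem IsPicardLefschetzData.of_loopClassUniv_eq {k : ℕ} {s : ComplexPoints (base ℂ n d)} {γ γ' : Path s s}
    {δ : Fin k → bettiCohomology (fiberOver (family ℂ n d) s) n} {c : ℚ}
    (h : IsPicardLefschetzData n d k hn hd hU γ δ c) (e : loopClassUniv n d γ' = loopClassUniv n d γ) :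
    IsPicardLefschetzData n d k hn hd hU γ' δ c := by
  unfold IsPicardLefschetzData at h ⊢
  rw [e]
  exact h

end Homotopy

/-- The class of the conjugate loop `κ · γ₁ · κ⁻¹` in the `loopClassUniv` indexing is the conjugate of the class
of `γ₁` by the class of `κ` (functoriality of `Path.map` and of the quotient map). [cite: Hatcher2002, §1.1 (p. 27, products of paths and their classes)] -/
theorem loopClassUniv_trans_trans_symm {s₂ s₁ : ComplexPoints (base ℂ n d)} (κ : Path s₂ s₁)
    (γ₁ : Path s₁ s₁) :
    loopClassUniv n d ((κ.trans γ₁).trans κ.symm) =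
      (Path.Homotopic.Quotient.mk (κ.map (toUniv n d).continuous)).trans
        ((loopClassUniv n d γ₁).trans
          (Path.Homotopic.Quotient.mk (κ.map (toUniv n d).continuous)).symm) := by
  show Path.Homotopic.Quotient.mk (((κ.trans γ₁).trans κ.symm).map (toUniv n d).continuous) =
    (Path.Homotopic.Quotient.mk (κ.map (toUniv n d).continuous)).trans
      ((Path.Homotopic.Quotient.mk (γ₁.map (toUniv n d).continuous)).trans
        (Path.Homotopic.Quotient.mk (κ.map (toUniv n d).continuous)).symm)
  rw [Path.map_trans, Path.map_trans, ← Path.map_symm, Path.Homotopic.Quotient.mk_trans,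
    Path.Homotopic.Quotient.mk_trans, Path.Homotopic.Quotient.mk_symm,
    Path.Homotopic.Quotient.trans_assoc]

/-- **Picard–Lefschetz data for concentric circles** (real radii, annulus of nonsingular members): Picard–Lefschetz
data `(δᵢ; c(s₁))` for the circle `γ₁` of radius `ε₁` at the point `s₁` of `f₁ + ε₁g` yield Picard–Lefschetz data
`(δ'ᵢ; c(s₂))` for the circle `γ₂` of radius `ε₂` at the point `s₂` of `f₁ + ε₂g`, for a FLAT coefficient `c`
(the cycles are transported along the radial segment: `IsPicardLefschetzData.exists_transport` of
`PicardLefschetzDataTransport`, then homotopy invariance along `[γ₂] = [κ]·[γ₁]·[κ]⁻¹`).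
[cite: VoisinHodgeII2003, §3.2.2 (construction of `δ_γ`), §3.1.2 and §2.3.1] [cite: Hatcher2002, §1.1 Lemma 1.19 (p. 37)] -/
theorem IsPicardLefschetzData.exists_of_concentric {k : ℕ} {hn : 1 ≤ n} {hd : 1 ≤ d}
    {hU : IsCohomologicallyLocallyTrivialOn (family ℂ n d) Set.univ} {c : ComplexPoints (base ℂ n d) → ℚ}
    (hc : IsFlatCoefficient n d hn hd hU c) {f₁ g : MvPolynomial (Fin (n + 2)) ℂ} (hf₁ : f₁.IsHomogeneous d)
    (hg : g.IsHomogeneous d) {ε₂ ε₁ : ℝ} (hε₂ : 0 ≤ ε₂) (hε₁ : 0 ≤ ε₁)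
    (hJ : ∀ c' : ℂ, ‖c'‖ ∈ Set.uIcc ε₂ ε₁ → SmoothHypersurface.IsNonsingularForm ℂ (f₁ + c' • g))
    {s₂ s₁ : ComplexPoints (base ℂ n d)} (hs₂ : pointForm ℂ n d s₂ = f₁ + (ε₂ : ℂ) • g)
    (hs₁ : pointForm ℂ n d s₁ = f₁ + (ε₁ : ℂ) • g) {γ₂ : Path s₂ s₂} {γ₁ : Path s₁ s₁}
    (h₂ : IsPencilCircle n d f₁ g ε₂ γ₂) (h₁ : IsPencilCircle n d f₁ g ε₁ γ₁)
    {δ : Fin k → bettiCohomology (fiberOver (family ℂ n d) s₁) n}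
    (hPL : IsPicardLefschetzData n d k hn hd hU γ₁ δ (c s₁)) :
    ∃ δ' : Fin k → bettiCohomology (fiberOver (family ℂ n d) s₂) n,
      IsPicardLefschetzData n d k hn hd hU γ₂ δ' (c s₂) := by
  obtain ⟨κ, hκ⟩ := exists_path_pointForm_radialSegment hf₁ hg (ε₂ := ε₂) (ε₁ := ε₁)
    (fun ρ hρ => hJ _ (by
      have hρ0 : 0 ≤ ρ := by
        rcases Set.mem_uIcc.1 hρ with h | h
        exacts [hε₂.trans h.1, hε₁.trans h.1]
      rwa [Complex.norm_real, Real.norm_eq_abs, abs_of_nonneg hρ0])) s₂ s₁ hs₂ hs₁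
  have hconjU := h₂.loopClassUniv_eq_conj_of_norm hf₁ hg hε₂ hε₁ hJ h₁ κ hκ
  obtain ⟨δ', hδ'⟩ := hPL.exists_transport hc κ
  exact ⟨δ', hδ'.of_loopClassUniv_eq (hconjU.trans (loopClassUniv_trans_trans_symm κ γ₁).symm)⟩

/-! ### §6 Picard–Lefschetz data at any radius, from the uniform Picard–Lefschetz fact -/

/-- **Picard–Lefschetz data for a circle of ANY radius inside the punctured disc of nonsingular members**
(consequence of the named fact `picardLefschetz_nodalForms_uniform`, which gives them for infinitesimal radii):
for `n, d ≥ 1` and every cohomological local trivialisation datum `hU`, there is a flat coefficient `c` such that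
for every `k`-nodal form `f₁` with nodes `p`, every `g` of the same degree missing the nodes, and every radius
`r > 0` such that all `f₁ + c'·g` with `0 < |c'| ≤ r` are nonsingular, every circle `γ` of radius `r` of the pencil
at the point `s` of `f₁ + r·g` carries Picard–Lefschetz data `(δᵢ)ᵢ` with coefficient `c(s)`
(`IsPicardLefschetzData n d k hn hd hU γ δ (c s)`). Proof: data at a radius `ε < min(ε₀, r)` from the fact,
moved to radius `r` by `IsPicardLefschetzData.exists_of_concentric`.
[cite: VoisinHodgeII2003, §3.2.1 Thm. 3.16, §3.2.2, §3.1.2 and §2.3.1] [cite: Hatcher2002, §1.1 Lemma 1.19 (p. 37)] -/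
theorem picardLefschetz_nodalForms_uniform.exists_isPicardLefschetzData_of_radius
    (H : picardLefschetz_nodalForms_uniform) (n d : ℕ) (hn : 1 ≤ n) (hd : 1 ≤ d)
    (hU : IsCohomologicallyLocallyTrivialOn (family ℂ n d) Set.univ) :
    ∃ c : ComplexPoints (base ℂ n d) → ℚ, IsFlatCoefficient n d hn hd hU c ∧
      ∀ (k : ℕ) (f₁ g : MvPolynomial (Fin (n + 2)) ℂ), f₁.IsHomogeneous d → g.IsHomogeneous d →
        ∀ (p : Fin k → Fin (n + 2) → ℂ), IsNodalFormWithNodes f₁ p → (∀ i, eval (p i) g ≠ 0) →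
          ∀ (r : ℝ), 0 < r →
            (∀ c' : ℂ, c' ≠ 0 → ‖c'‖ ≤ r → SmoothHypersurface.IsNonsingularForm ℂ (f₁ + c' • g)) →
              ∀ (s : ComplexPoints (base ℂ n d)), pointForm ℂ n d s = f₁ + (r : ℂ) • g →
                ∀ (γ : Path s s), IsPencilCircle n d f₁ g r γ →
                  ∃ δ : Fin k → bettiCohomology (fiberOver (family ℂ n d) s) n,
                    IsPicardLefschetzData n d k hn hd hU γ δ (c s) := by
  obtain ⟨c, hc, hPL⟩ := H n d hn hd hU
  refine ⟨c, hc, fun k f₁ g hf₁ hg p hp hgp r hr hJr s hs γ hγ => ?_⟩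
  obtain ⟨ε₀, hε₀, -, hrest⟩ := hPL k f₁ g hf₁ hg p hp hgp
  -- an infinitesimal radius `ε` inside `(0, r]`
  obtain ⟨ε, hε0, hε1, hεr⟩ : ∃ ε : ℝ, 0 < ε ∧ ε < ε₀ ∧ ε ≤ r :=
    ⟨min (ε₀ / 2) r, lt_min (half_pos hε₀) hr, lt_of_le_of_lt (min_le_left _ _) (half_lt_self hε₀),
      min_le_right _ _⟩
  -- members of norm in `[ε, r]` are nonsingular
  have hJεr : ∀ c' : ℂ, ‖c'‖ ∈ Set.uIcc r ε → SmoothHypersurface.IsNonsingularForm ℂ (f₁ + c' • g) := by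
    intro c' hc'
    rw [Set.uIcc_of_ge hεr] at hc'
    have hne : c' ≠ 0 := fun h0 => by
      rw [h0, norm_zero] at hc'
      exact absurd hc'.1 (not_le.2 hε0)
    exact hJr c' hne hc'.2
  -- the point `s₁` of `f₁ + ε g` and the circle `γ₁` of radius `ε` there
  have hJε : ∀ c' : ℂ, ‖c'‖ = |ε| → SmoothHypersurface.IsNonsingularForm ℂ (f₁ + c' • g) := fun c' hc' =>
    hJεr c' (by rw [hc', abs_of_pos hε0, Set.uIcc_of_ge hεr]; exact ⟨le_rfl, hεr⟩)
  obtain ⟨s₁, hs₁⟩ := exists_point_of_isNonsingularForm ℂ n d (isHomogeneous_add_smul hf₁ hg (ε : ℂ))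
    (hJε _ (by rw [Complex.norm_real, Real.norm_eq_abs]))
  obtain ⟨γ₁, hγ₁⟩ := exists_isPencilCircle hf₁ hg hJε s₁ hs₁
  -- Picard–Lefschetz data at radius `ε`, moved to radius `r`
  obtain ⟨δ₁, hPL₁, -⟩ := hrest ε hε0 hε1 s₁ hs₁ γ₁ hγ₁
  exact hPL₁.exists_of_concentric hc hf₁ hg hr.le hε0.le hJεr hs hs₁ hγ hγ₁

/-! ### §7 (appended) Packaged shapes for consumers of `picardLefschetz_nodalForms_uniform`

The fact's `∀ γ`-clause feeds a GIVEN outer circle `γ₂` at a GIVEN point `s₂`; the consumer wants the inner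
point, circle and radial segment PRODUCED, together with the class relation and the conjugation of transports
(request of the prover seat `hodge-nonav-19716-p2`, g9). -/

/-- The base point of a pencil circle of radius `ε` is the point of `f₁ + ε·g` (evaluate at `θ = 0`).
[cite: VoisinHodgeII2003, §3.2.1 (before Thm. 3.16)] -/
theorem IsPencilCircle.pointForm_base {f₁ g : MvPolynomial (Fin (n + 2)) ℂ} {ε : ℝ}
    {s : ComplexPoints (base ℂ n d)} {γ : Path s s} (h : IsPencilCircle n d f₁ g ε γ) :
    pointForm ℂ n d s = f₁ + (ε : ℂ) • g := by
  have h0 := h 0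
  rw [γ.source] at h0
  rw [h0]
  simp

section Packaged

variable {hn : 1 ≤ n} {hd : 1 ≤ d}

/-- **Inner circle, radial segment and class relation, produced from a given outer circle.** If `0 ≤ ε₂, ε₁` and
every `f₁ + c'·g` with `|c'|` between `ε₂` and `ε₁` is nonsingular, then for every pencil circle `γ₂` of radius
`ε₂` (at its base point `s₂`, of form `f₁ + ε₂g`) there are the point `s₁` of `f₁ + ε₁g`, the radial segment `κ`
from `s₂` to `s₁` and a pencil circle `γ₁` of radius `ε₁` at `s₁` with
`loopClassUniv γ₂ = [κ]·loopClassUniv γ₁·[κ]⁻¹`. [cite: VoisinHodgeII2003, §2.3.1, §3.1.1 and §6.2.1]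
[cite: Hatcher2002, §1.1 Lemma 1.19 (p. 37)] -/
theorem IsPencilCircle.exists_concentric {f₁ g : MvPolynomial (Fin (n + 2)) ℂ} (hf₁ : f₁.IsHomogeneous d)
    (hg : g.IsHomogeneous d) {ε₂ ε₁ : ℝ} (hε₂ : 0 ≤ ε₂) (hε₁ : 0 ≤ ε₁)
    (hJ : ∀ c' : ℂ, ‖c'‖ ∈ Set.uIcc ε₂ ε₁ → SmoothHypersurface.IsNonsingularForm ℂ (f₁ + c' • g))
    {s₂ : ComplexPoints (base ℂ n d)} {γ₂ : Path s₂ s₂} (h₂ : IsPencilCircle n d f₁ g ε₂ γ₂) :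
    ∃ (s₁ : ComplexPoints (base ℂ n d)) (κ : Path s₂ s₁) (γ₁ : Path s₁ s₁),
      pointForm ℂ n d s₁ = f₁ + (ε₁ : ℂ) • g ∧ IsPencilCircle n d f₁ g ε₁ γ₁ ∧
        (∀ t : unitInterval, pointForm ℂ n d (κ t) =
          f₁ + (((1 - (t : ℝ)) * ε₂ + (t : ℝ) * ε₁ : ℝ) : ℂ) • g) ∧
        loopClassUniv n d γ₂ =
          (Path.Homotopic.Quotient.mk (κ.map (toUniv n d).continuous)).trans
            ((loopClassUniv n d γ₁).trans
              (Path.Homotopic.Quotient.mk (κ.map (toUniv n d).continuous)).symm) := by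
  have hε₁mem : ε₁ ∈ Set.uIcc ε₂ ε₁ := Set.right_mem_uIcc
  have hJ₁ : ∀ c' : ℂ, ‖c'‖ = |ε₁| → SmoothHypersurface.IsNonsingularForm ℂ (f₁ + c' • g) :=
    fun c' hc' => hJ c' (by rw [hc', abs_of_nonneg hε₁]; exact hε₁mem)
  obtain ⟨s₁, hs₁⟩ := exists_point_of_isNonsingularForm ℂ n d (isHomogeneous_add_smul hf₁ hg (ε₁ : ℂ))
    (hJ₁ _ (by rw [Complex.norm_real, Real.norm_eq_abs]))
  obtain ⟨γ₁, hγ₁⟩ := exists_isPencilCircle hf₁ hg hJ₁ s₁ hs₁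
  obtain ⟨κ, hκ⟩ := exists_path_pointForm_radialSegment hf₁ hg (ε₂ := ε₂) (ε₁ := ε₁)
    (fun ρ hρ => hJ _ (by
      have hρ0 : 0 ≤ ρ := by
        rcases Set.mem_uIcc.1 hρ with h | h
        exacts [hε₂.trans h.1, hε₁.trans h.1]
      rwa [Complex.norm_real, Real.norm_eq_abs, abs_of_nonneg hρ0])) s₂ s₁ h₂.pointForm_base hs₁
  exact ⟨s₁, κ, γ₁, hs₁, hγ₁, hκ, h₂.loopClassUniv_eq_conj_of_norm hf₁ hg hε₂ hε₁ hJ hγ₁ κ hκ⟩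

/-- **The same with the conjugation of rational transports** (`n, d ≥ 1`): in addition there is the rational
transport `K` of `Rⁿ π_* ℚ` along the radial segment, and for every rational transport `T₁` along `γ₁`,
`K ≫ T₁ ≫ K⁻¹` is the rational transport along `γ₂` (so the monodromy of the outer circle is conjugate to that of
the inner one). [cite: VoisinHodgeII2003, §3.1.2 and §2.3.1] [cite: Hatcher2002, §1.1 Lemma 1.19 (p. 37)] -/
theorem IsPencilCircle.exists_concentric_ratTransport {f₁ g : MvPolynomial (Fin (n + 2)) ℂ}
    (hf₁ : f₁.IsHomogeneous d) (hg : g.IsHomogeneous d) (hd : 1 ≤ d)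
    (hU : IsCohomologicallyLocallyTrivialOn (family ℂ n d) Set.univ) (k' : ℕ) {ε₂ ε₁ : ℝ} (hε₂ : 0 ≤ ε₂)
    (hε₁ : 0 ≤ ε₁)
    (hJ : ∀ c' : ℂ, ‖c'‖ ∈ Set.uIcc ε₂ ε₁ → SmoothHypersurface.IsNonsingularForm ℂ (f₁ + c' • g))
    {s₂ : ComplexPoints (base ℂ n d)} {γ₂ : Path s₂ s₂} (h₂ : IsPencilCircle n d f₁ g ε₂ γ₂) :
    ∃ (s₁ : ComplexPoints (base ℂ n d)) (κ : Path s₂ s₁) (γ₁ : Path s₁ s₁)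
      (K : bettiCohomology (fiberOver (family ℂ n d) s₂) k' ≃ₗ[ℚ] bettiCohomology (fiberOver (family ℂ n d) s₁) k'),
      pointForm ℂ n d s₁ = f₁ + (ε₁ : ℂ) • g ∧ IsPencilCircle n d f₁ g ε₁ γ₁ ∧
        (∀ t : unitInterval, pointForm ℂ n d (κ t) =
          f₁ + (((1 - (t : ℝ)) * ε₂ + (t : ℝ) * ε₁ : ℝ) : ℂ) • g) ∧
        loopClassUniv n d γ₂ =
          (Path.Homotopic.Quotient.mk (κ.map (toUniv n d).continuous)).trans
            ((loopClassUniv n d γ₁).trans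
              (Path.Homotopic.Quotient.mk (κ.map (toUniv n d).continuous)).symm) ∧
        IsRatTransport (family ℂ n d) k' hU (Path.Homotopic.Quotient.mk (κ.map (toUniv n d).continuous)) K ∧
        ∀ T₁ : bettiCohomology (fiberOver (family ℂ n d) s₁) k' ≃ₗ[ℚ]
            bettiCohomology (fiberOver (family ℂ n d) s₁) k',
          IsRatTransport (family ℂ n d) k' hU (loopClassUniv n d γ₁) T₁ →
            IsRatTransport (family ℂ n d) k' hU (loopClassUniv n d γ₂) (K.trans (T₁.trans K.symm)) := by
  obtain ⟨s₁, κ, γ₁, hs₁, hγ₁, hκ, hconj⟩ := h₂.exists_concentric hf₁ hg hε₂ hε₁ hJ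
  obtain ⟨K, hK⟩ := exists_isRatTransport_family hd k' hU
    (Path.Homotopic.Quotient.mk (κ.map (toUniv n d).continuous))
  exact ⟨s₁, κ, γ₁, K, hs₁, hγ₁, hκ, hconj, hK,
    fun T₁ hT₁ => isRatTransport_conj_of_loopClassUniv_eq hU hconj hK hT₁⟩

end Packaged

end HodgeTheory

end Literature.AlgebraicGeometry.HodgeTheory

end
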